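import Summits.QuantumFields.YangMills.Theorems.AlphaInputsT3ACPint
import Summits.QuantumFields.YangMills.Theorems.UV3UnitPartitionLowerOfPackageV3
import HarnessLib

/-!
# S-BRIDGE — THE REGISTERED `stub_pinnedStep` (v2′: the PINNED (41) DENSITY BOUND RELATIVE TO AN A.E. ENVELOPE `M`) FROM ITS `E`-ANCHORED TWIN AND THE (47)-HALF:
# the envelope exchange `M ≥ ∫ρ_K ≥ e^{−E−Cl}`, kernel-checked, generically and at the two T3 (α) sockets

Cell `ym3-torus` (YM ladder rung R3 = continuum `SU(2)` Yang–Mills on the three-torus — a RUNG, NOT d = 4, NOT infinite volume, NOT a mass gap, NOT Clay).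
Twin-width seat `ym-ust-19936-w8` (gen 11); `--supports stmt-QuantumFields-19936 --as helper`, count-neutral, definition-free, default heartbeats.
Crux `UnitScaleTilt.HistoryTailL` (stmt-QuantumFields-19936), skeleton of record `Cruxes/HistoryTailL/Lines/pinned_stability.lean` v2′ (★★OWNER RECORD 17aq): row R-19936-S =
`stub_pinnedStep` (XL).

THE POINT.  The registered S-step says, per `(K, j, a)` and for EVERY real `M`: «`ρ_K ≤ M` a.e. ⟹ `ρ^{E(K,j,a)}_K ≤ M·e^{Cu}·β_{K−j}^A·e^{−c·p(g_{K−j})²}` a.e.» (bare-tower wording,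
★★OWNER WORD 50∕51 option (1)).  What an XL hand on R-19936-S will actually prove is print's (41) p.266 with the characteristic functions of (7) p.257 PINNED to the event,
i.e. an `E`-ANCHORED bound «`ρ^{E(K,j,a)}_K ≤ e^{−E_K + Cu}·w` a.e.» (S-step″; `E_K` = print's vacuum-energy constant (64) p.273, in the tree the datum `AlphaDataT3.Ecst K K`;
the `hUP` letter of ✓`UV3PinnedRatioOfTowerBounds`∕✓`UV3PinnedTowerAeBridge`).  The two wordings differ by ONE trade through the (47)-half `e^{−E_K − Cl} ≤ Z_K = ∫ρ_K dV_K`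
((47) p.267 ∕ (5) p.256 — ✓`UV3UnitPartitionLowerOfPackage`, ✓`UV3UnitPartitionLowerOfPackageV3`, ✓`AlphaInputsT3ACPint`): an a.e. envelope `M` of `ρ_K` dominates its mass,
`M ≥ ∫ρ_K ≥ e^{−E_K−Cl}`, hence `e^{−E_K} ≤ e^{Cl}·M` (mechanism memo `MECHANISM-PINNED41-px8g10.md`: «its inhabitant uses pinned (41) AND (47)»).  THIS FILE types that trade:
* §1 ★★ `ae_resDensity_le_envelope_of_anchored` — per run and event: (Z-UP) `ρ^S_K ≤ e^{−E₀+Cu}·w` a.e. ∧ (Z-LOW) `e^{−E₀−Cl} ≤ ∫ρ_K` ⟹ ∀ M, (`ρ_K ≤ M` a.e.) →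
  `ρ^S_K ≤ M·e^{Cu+Cl}·w` a.e.
* §2 ★★★ `stub_pinnedStep_of_anchoredPair` — THE REGISTERED TEXT `PinnedStability.stub_pinnedStep` VERBATIM from ONE row with the same quantifier prefix: per `(F, γ)` an
  ANCHORED PAIR `∃ (E : ℕ → ℝ) Cu Cl c A, 0 < c ∧ (∀ K, e^{−E K − Cl} ≤ ∫ρ_K) ∧ (∀ K j ⟨guards⟩ a, ρ^{E(K,j,a)}_K ≤ e^{−E K + Cu}·β^A·e^{−cp²} a.e.)` — any anchor `E`.
* §3 at the sockets, per `(F, γ)`, the (47)-half DISCHARGED BY NAME: ★★ `AlphaInputsT3AC.Of.pinnedStep_inner_of_anchored_of_main` (v1 socket `AlphaInputsT3AC.Of F 𝔠`, anchor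
  `(dataT3).Ecst K K`, via ✓`exp_Ecst_le_partitionFn_of_package_of_main`; the membership∕main-term row `hMain` stays displayed) and ★★
  `AlphaInputsT3AC.OfV3At.pinnedStep_inner_of_anchored` (v3 socket, anchor `(dataT3v3).Ecst K K`, via ✓`exp_Ecst_le_partitionFn_of_packageV3`; no `hMain`, the two
  smallness rows `θBal(0) ≤ a₁`, `B₃θBal(0) ≤ a₀` carried): S-step's INNER CLAUSE `∃ Cu c A, 0 < c ∧ ∀ K j ⟨guards⟩ a M, (ρ_K ≤ M a.e.) → (ρ^E_K ≤ M·e^{Cu}·w a.e.)` from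
  the anchored clause `∃ Cu c A, 0 < c ∧ ∀ K j ⟨guards⟩ a, ρ^E_K ≤ e^{−Ecst K K + Cu}·w a.e.` alone.

HONEST SCOPE.  Bookkeeping (one `integral_mono_ae` and exponent arithmetic); the anchored pinned (41) — R-19936-S's organ (the UV-stability induction re-run with pinned
characteristic functions) — is DISPLAYED, not proved; CONDITIONAL on the sockets in §3; nothing of `stub_pinnedStep`, `stub_unitEnvelope`, `stub_pinnedRatio`∕`hP`,
`HistoryTailL` (19936) or the rung is proved here.  Sorry-free, axioms standard.

References: T. Bałaban, *Ultraviolet stability of three-dimensional lattice pure gauge field theories*, Commun. Math. Phys. **102** (1985) 255–275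
[Balaban1985UV3] ((2) p.256, (5)–(7) pp.256–257, (41) p.266, (47) p.267, (64) p.273, (70)–(71) p.273).
-/

set_option autoImplicit false

noncomputable section

namespace Summit.QuantumFields.YangMills.Theorems.UV3PinnedStepOfAnchored

open MeasureTheory
open Literature.MathematicalPhysics.QuantumFieldTheory.Balaban1983to89
open Literature.MathematicalPhysics.QuantumFieldTheory.Balaban1983to89.T3ContinuumYM3Torus
open Literature.MathematicalPhysics.QuantumFieldTheory.Balaban1983to89.T3UnitLawDensityEML (ℰp emlDensity integrable_emlDensity)
open Literature.MathematicalPhysics.QuantumFieldTheory.Balaban1983to89.T3UnitScaleTilt (θBal)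
open Literature.MathematicalPhysics.QuantumFieldTheory.Balaban1983to89.T3RestrictedUnitDensity (resDensity)
open Literature.MathematicalPhysics.QuantumFieldTheory.Balaban1983to89.T3AlphaInputsAC
open Literature.MathematicalPhysics.QuantumFieldTheory.Balaban1983to89.Missing (isProbabilityMeasure_fieldMeasure)
open Literature.MathematicalPhysics.QuantumFieldTheory.Balaban1985CMP102
open Literature.MathematicalPhysics.QuantumFieldTheory.Balaban1985CMP102.Setting
open Summit.QuantumFields.Balaban3D.Carriers
open Summit.QuantumFields.Balaban3D.Proofs.Primitives
open Summit.QuantumFields.YangMills.Theorems.UV3UnitPartitionLowerOfPackageV3 (exp_Ecst_le_partitionFn_of_packageV3)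

/-! ## §1 Per run and event: the envelope exchange -/

/-- ★★ **THE ENVELOPE EXCHANGE, PER RUN AND EVENT.**  For the `K`-th approximation (`0 ≤ γ`), a set `S` of finest-lattice fields and reals `E₀ Cu Cl w`, `0 ≤ w`: IF the
final restricted density of `S` is bounded a.e. by the ANCHORED envelope, `ρ^S_K ≤ e^{−E₀ + Cu}·w`, and the mass of the un-restricted density is bounded below with the SAME
anchor, `e^{−E₀ − Cl} ≤ ∫ρ_K dV_K`, THEN for every real `M` that bounds `ρ_K` a.e. one has `ρ^S_K ≤ M·e^{Cu + Cl}·w` a.e. — because `∫ρ_K ≤ M` (product Haar is a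
probability measure, `integral_mono_ae` with lit ✓`integrable_emlDensity`), so `e^{−E₀} ≤ e^{Cl}·M`.  ((41) p.266 pinned, against (47) p.267 ∕ (5) p.256: «its inhabitant uses
pinned (41) AND (47)».) [cite: Balaban1985UV3, (5) p.256, (41) p.266, (47) p.267] -/
theorem ae_resDensity_le_envelope_of_anchored (F : T3Family) {γ : ℝ} (hγ : 0 ≤ γ) (K : ℕ)
    (S : Set (GaugeField (F.P K) 0 (Matrix.specialUnitaryGroup (Fin 2) ℂ))) {E₀ Cu Cl w : ℝ} (hw : 0 ≤ w)
    (hUP : ∀ᵐ V ∂fieldMeasure (F.P K) K (Matrix.specialUnitaryGroup (Fin 2) ℂ), resDensity F γ K S K V ≤ Real.exp (-E₀ + Cu) * w)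
    (hLOW : Real.exp (-E₀ - Cl) ≤ ∫ V, emlDensity F γ K K V ∂fieldMeasure (F.P K) K (Matrix.specialUnitaryGroup (Fin 2) ℂ))
    (M : ℝ) (hM : ∀ᵐ V ∂fieldMeasure (F.P K) K (Matrix.specialUnitaryGroup (Fin 2) ℂ), emlDensity F γ K K V ≤ M) :
    ∀ᵐ V ∂fieldMeasure (F.P K) K (Matrix.specialUnitaryGroup (Fin 2) ℂ), resDensity F γ K S K V ≤ M * Real.exp (Cu + Cl) * w := by
  haveI : IsProbabilityMeasure (fieldMeasure (F.P K) K (Matrix.specialUnitaryGroup (Fin 2) ℂ)) :=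
    isProbabilityMeasure_fieldMeasure _ _
  -- the envelope dominates the mass: `∫ρ_K ≤ M`
  have hZM : (∫ V, emlDensity F γ K K V ∂fieldMeasure (F.P K) K (Matrix.specialUnitaryGroup (Fin 2) ℂ)) ≤ M := by
    have hmono := integral_mono_ae (integrable_emlDensity F K hγ K (Nat.le_add_left K F.m)) (integrable_const M) hM
    simpa [integral_const, smul_eq_mul] using hmono
  -- hence `e^{−E₀} ≤ e^{Cl}·M`
  have hE : Real.exp (-E₀) ≤ Real.exp Cl * M := by
    have h1 : Real.exp (-E₀) = Real.exp Cl * Real.exp (-E₀ - Cl) := by rw [← Real.exp_add]; ring_nf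
    rw [h1]
    exact mul_le_mul_of_nonneg_left (hLOW.trans hZM) (Real.exp_pos _).le
  filter_upwards [hUP] with V hV
  calc resDensity F γ K S K V ≤ Real.exp (-E₀ + Cu) * w := hV
    _ = Real.exp (-E₀) * (Real.exp Cu * w) := by rw [Real.exp_add]; ring
    _ ≤ (Real.exp Cl * M) * (Real.exp Cu * w) := mul_le_mul_of_nonneg_right hE (mul_nonneg (Real.exp_pos _).le hw)
    _ = M * Real.exp (Cu + Cl) * w := by rw [Real.exp_add]; ring

/-! ## §2 The registered S-step text from one anchored row -/

/-- ★★★ **`PinnedStability.stub_pinnedStep` (the 19936 skeleton of record's S-step, its text VERBATIM) FROM THE ANCHORED PAIR.**  Same quantifier prefix; per `(F, γ)` the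
row supplies SOME anchor sequence `E : ℕ → ℝ` (print: `E_K` of (64); the sockets: `AlphaDataT3.Ecst K K`), the (47)-half `e^{−E K − Cl} ≤ ∫ρ_K dV_K` for every run, and the
anchored pinned (41) `ρ^{E(K,j,a)}_K ≤ e^{−E K + Cu}·β_{K−j}^A·e^{−c·p(g_{K−j})²}` a.e. at the constrained heights; §1 trades the anchor for any a.e. envelope `M` of `ρ_K`
(`Cu ↦ Cu + Cl`).  A FACE (conclusion = the registered stub statement, hypothesis = one named row); the anchored pinned (41) is R-19936-S's organ and is NOT proved here.
[cite: Balaban1985UV3, (5) p.256, (7) p.257, (41) p.266, (47) p.267, (64) p.273, (70)–(71) p.273] -/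
theorem stub_pinnedStep_of_anchoredPair
    (hA : ∀ (L : ℕ), ∃ (b₁' p₁' : ℝ), ∀ (b₀ p₀ : ℝ), b₁' ≤ b₀ → p₁' ≤ p₀ → 0 < b₀ → 2 < p₀ → ∀ (m : ℕ), 0 < m →
      ∃ γ₁ : ℝ, 0 < γ₁ ∧ γ₁ ≤ 1 ∧ ∀ (F : T3Family) (γ : ℝ), F.L = L → 0 < γ → γ ≤ γ₁ →
        ∃ (E : ℕ → ℝ) (Cu Cl c : ℝ) (A : ℕ), 0 < c ∧
          (∀ K : ℕ, Real.exp (-E K - Cl) ≤ ∫ V, emlDensity F γ K K V ∂fieldMeasure (F.P K) K (Matrix.specialUnitaryGroup (Fin 2) ℂ)) ∧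
          ∀ (K j : ℕ), 1 ≤ j → j + 2 ≤ K → j + (K - 1) / m ≤ K → ∀ (a : Plaq (F.P K) j),
            ∀ᵐ V ∂(fieldMeasure (F.P K) K (Matrix.specialUnitaryGroup (Fin 2) ℂ)),
              resDensity F γ K
                ({U : GaugeField (F.P K) 0 (Matrix.specialUnitaryGroup (Fin 2) ℂ) |
                    θBal F.L γ b₀ p₀ (K - j) ≤ GaugeGroup.dist1 (GaugeField.plaqHol
                      (Averaging.iter (fun i' => BlockAveraging.blockAvg (P := F.P K) (j := i') ℰp) j U) a)} ∩
                  {U : GaugeField (F.P K) 0 (Matrix.specialUnitaryGroup (Fin 2) ℂ) | ∀ i, i < j →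
                    PlaqSmall (θBal F.L γ b₀ p₀ (K - i))
                      (Averaging.iter (fun i' => BlockAveraging.blockAvg (P := F.P K) (j := i') ℰp) i U)})
                K V ≤
              Real.exp (-E K + Cu) *
                ((F.scheme ℰp γ).β (K - j) ^ A * Real.exp (-(c * B10.pFun b₀ p₀ (Real.sqrt (γ * ((F.L : ℝ)⁻¹) ^ (K - j))) ^ 2)))) :
    ∀ (L : ℕ), ∃ (b₁' p₁' : ℝ), ∀ (b₀ p₀ : ℝ), b₁' ≤ b₀ → p₁' ≤ p₀ → 0 < b₀ → 2 < p₀ → ∀ (m : ℕ), 0 < m →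
      ∃ γ₁ : ℝ, 0 < γ₁ ∧ γ₁ ≤ 1 ∧ ∀ (F : T3Family) (γ : ℝ), F.L = L → 0 < γ → γ ≤ γ₁ →
        ∃ (Cu c : ℝ) (A : ℕ), 0 < c ∧ ∀ (K j : ℕ), 1 ≤ j → j + 2 ≤ K → j + (K - 1) / m ≤ K → ∀ (a : Plaq (F.P K) j) (M : ℝ),
          (∀ᵐ V ∂(fieldMeasure (F.P K) K (Matrix.specialUnitaryGroup (Fin 2) ℂ)), emlDensity F γ K K V ≤ M) →
          ∀ᵐ V ∂(fieldMeasure (F.P K) K (Matrix.specialUnitaryGroup (Fin 2) ℂ)),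
            resDensity F γ K
              ({U : GaugeField (F.P K) 0 (Matrix.specialUnitaryGroup (Fin 2) ℂ) |
                  θBal F.L γ b₀ p₀ (K - j) ≤ GaugeGroup.dist1 (GaugeField.plaqHol
                    (Averaging.iter (fun i' => BlockAveraging.blockAvg (P := F.P K) (j := i') ℰp) j U) a)} ∩
                {U : GaugeField (F.P K) 0 (Matrix.specialUnitaryGroup (Fin 2) ℂ) | ∀ i, i < j →
                  PlaqSmall (θBal F.L γ b₀ p₀ (K - i))
                    (Averaging.iter (fun i' => BlockAveraging.blockAvg (P := F.P K) (j := i') ℰp) i U)})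
              K V ≤
            M * Real.exp Cu *
              ((F.scheme ℰp γ).β (K - j) ^ A * Real.exp (-(c * B10.pFun b₀ p₀ (Real.sqrt (γ * ((F.L : ℝ)⁻¹) ^ (K - j))) ^ 2))) := by
  intro L
  obtain ⟨b₁', p₁', HA⟩ := hA L
  refine ⟨b₁', p₁', fun b₀ p₀ hb hp hb₀ hp₀ m hm => ?_⟩
  obtain ⟨γ₁, hγ₁, hγ₁1, HF⟩ := HA b₀ p₀ hb hp hb₀ hp₀ m hm
  refine ⟨γ₁, hγ₁, hγ₁1, fun F γ hFL hγ hγle => ?_⟩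
  obtain ⟨E, Cu, Cl, c, A, hc, hlow, hstep⟩ := HF F γ hFL hγ hγle
  refine ⟨Cu + Cl, c, A, hc, fun K j hj1 hjK hjm a M hM => ?_⟩
  have hw : 0 ≤ (F.scheme ℰp γ).β (K - j) ^ A *
      Real.exp (-(c * B10.pFun b₀ p₀ (Real.sqrt (γ * ((F.L : ℝ)⁻¹) ^ (K - j))) ^ 2)) :=
    mul_nonneg (pow_nonneg (F.scheme_β_nonneg ℰp hγ.le (K - j)) A) (Real.exp_nonneg _)
  exact ae_resDensity_le_envelope_of_anchored F hγ.le K _ hw (hstep K j hj1 hjK hjm a) (hlow K) M hM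

/-! ## §3 At the sockets, per `(F, γ)`: the (47)-half discharged by name -/

section SocketV1

variable {F : T3Family} {𝔠 : AlphaConsts F.L (suGroupModel 2).N}
  (h : AlphaInputsT3AC.Of F 𝔠) (γ : ℝ) (hγ : 0 < γ) (hγ1 : γ ≤ (min 𝔠.gamma0 1) ^ 2) (π : AlphaInputsT3AC.PolymerT3 F)

/-- ★★ **S-step's INNER CLAUSE PER `(F, γ)` OVER THE v1 SOCKET, FROM THE ANCHORED CLAUSE AND THE MAIN-TERM ROW.**  Under `AlphaInputsT3AC.Of F 𝔠` at `γ ∈ (0, (min γ₀ 1)²]`,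
profile `(b₀, p₀)`, depth `m`: IF the pinned (41) holds ANCHORED AT THE SOCKET's `Ecst K K` (`∃ Cu c A, 0 < c ∧ ∀ K j ⟨guards⟩ a, ρ^{E(K,j,a)}_K ≤ e^{−Ecst K K + Cu}·β^A·e^{−cp²}`
a.e.) and the trivial-history main term is bounded on the window (`hMain`, the EX-lane membership row), THEN S-step's inner clause holds: `∃ Cu c A, 0 < c ∧ ∀ K j ⟨guards⟩ a M,
(ρ_K ≤ M a.e.) → ρ^{E(K,j,a)}_K ≤ M·e^{Cu}·β^A·e^{−cp²} a.e.` — the (47)-half by ✓`AlphaInputsT3ACPint.exp_Ecst_le_partitionFn_of_package_of_main`, the trade by §1.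
[cite: Balaban1985UV3, (5) p.256, (41) p.266, (47) p.267, (64) p.273] -/
theorem _root_.Summit.QuantumFields.YangMills.Theorems.AlphaInputsT3AC.Of.pinnedStep_inner_of_anchored_of_main (b₀ p₀ : ℝ) (m : ℕ)
    (hMain : ∃ Cm : ℝ, ∀ (K : ℕ) (W : GaugeField (F.P K) K (Matrix.specialUnitaryGroup (Fin 2) ℂ)),
      PlaqSmall (θBal F.L γ 𝔠.b₀ 𝔠.p₀ 0) W →
        (h.dataT3 γ hγ hγ1 π).mainT K K ((h.dataT3 γ hγ hγ1 π).triv K K) W ≤ Cm)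
    (hStepA : ∃ (Cu c : ℝ) (A : ℕ), 0 < c ∧
      ∀ (K j : ℕ), 1 ≤ j → j + 2 ≤ K → j + (K - 1) / m ≤ K → ∀ (a : Plaq (F.P K) j),
        ∀ᵐ V ∂(fieldMeasure (F.P K) K (Matrix.specialUnitaryGroup (Fin 2) ℂ)),
          resDensity F γ K
            ({U : GaugeField (F.P K) 0 (Matrix.specialUnitaryGroup (Fin 2) ℂ) |
                θBal F.L γ b₀ p₀ (K - j) ≤ GaugeGroup.dist1 (GaugeField.plaqHol
                  (Averaging.iter (fun i' => BlockAveraging.blockAvg (P := F.P K) (j := i') ℰp) j U) a)} ∩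
              {U : GaugeField (F.P K) 0 (Matrix.specialUnitaryGroup (Fin 2) ℂ) | ∀ i, i < j →
                PlaqSmall (θBal F.L γ b₀ p₀ (K - i))
                  (Averaging.iter (fun i' => BlockAveraging.blockAvg (P := F.P K) (j := i') ℰp) i U)})
            K V ≤
          Real.exp (-((h.dataT3 γ hγ hγ1 π).Ecst K K) + Cu) *
            ((F.scheme ℰp γ).β (K - j) ^ A * Real.exp (-(c * B10.pFun b₀ p₀ (Real.sqrt (γ * ((F.L : ℝ)⁻¹) ^ (K - j))) ^ 2)))) :
    ∃ (Cu c : ℝ) (A : ℕ), 0 < c ∧ ∀ (K j : ℕ), 1 ≤ j → j + 2 ≤ K → j + (K - 1) / m ≤ K → ∀ (a : Plaq (F.P K) j) (M : ℝ),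
      (∀ᵐ V ∂(fieldMeasure (F.P K) K (Matrix.specialUnitaryGroup (Fin 2) ℂ)), emlDensity F γ K K V ≤ M) →
      ∀ᵐ V ∂(fieldMeasure (F.P K) K (Matrix.specialUnitaryGroup (Fin 2) ℂ)),
        resDensity F γ K
          ({U : GaugeField (F.P K) 0 (Matrix.specialUnitaryGroup (Fin 2) ℂ) |
              θBal F.L γ b₀ p₀ (K - j) ≤ GaugeGroup.dist1 (GaugeField.plaqHol
                (Averaging.iter (fun i' => BlockAveraging.blockAvg (P := F.P K) (j := i') ℰp) j U) a)} ∩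
            {U : GaugeField (F.P K) 0 (Matrix.specialUnitaryGroup (Fin 2) ℂ) | ∀ i, i < j →
              PlaqSmall (θBal F.L γ b₀ p₀ (K - i))
                (Averaging.iter (fun i' => BlockAveraging.blockAvg (P := F.P K) (j := i') ℰp) i U)})
          K V ≤
        M * Real.exp Cu *
          ((F.scheme ℰp γ).β (K - j) ^ A * Real.exp (-(c * B10.pFun b₀ p₀ (Real.sqrt (γ * ((F.L : ℝ)⁻¹) ^ (K - j))) ^ 2))) := by
  obtain ⟨Cu, c, A, hc, hstep⟩ := hStepA
  obtain ⟨Cl, hlow⟩ := h.exp_Ecst_le_partitionFn_of_package_of_main γ hγ hγ1 π hMain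
  refine ⟨Cu + Cl, c, A, hc, fun K j hj1 hjK hjm a M hM => ?_⟩
  have hw : 0 ≤ (F.scheme ℰp γ).β (K - j) ^ A *
      Real.exp (-(c * B10.pFun b₀ p₀ (Real.sqrt (γ * ((F.L : ℝ)⁻¹) ^ (K - j))) ^ 2)) :=
    mul_nonneg (pow_nonneg (F.scheme_β_nonneg ℰp hγ.le (K - j)) A) (Real.exp_nonneg _)
  exact ae_resDensity_le_envelope_of_anchored F hγ.le K _ hw (hstep K j hj1 hjK hjm a) (hlow K) M hM

end SocketV1

section SocketV3

variable {F : T3Family} {𝔠 : AlphaConsts F.L (suGroupModel 2).N} {a₀ a₁ : ℝ}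
  (h : AlphaInputsT3AC.OfV3At F 𝔠 a₀ a₁) (hc : 0 < a₀ ∧ 0 < a₁ ∧ 𝔠.B₃ * a₁ ≤ a₀) (γ : ℝ) (hγ : 0 < γ)
  (hγ1 : γ ≤ (min 𝔠.gamma0 1) ^ 2) (π : AlphaInputsT3AC.PolymerT3 F)

/-- ★★ **S-step's INNER CLAUSE PER `(F, γ)` OVER THE v3 SOCKET, FROM THE ANCHORED CLAUSE ALONE** (plus the two smallness rows `θBal(0) ≤ a₁`, `B₃·θBal(0) ≤ a₀` of the v3
(47)-half — met by the stub's own `γ₁` since `θBal(0) → 0`): the (47)-half by ✓`UV3UnitPartitionLowerOfPackageV3.exp_Ecst_le_partitionFn_of_packageV3` (`ym3-torus-px12` g12: no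
membership row left over the v3 socket), the trade by §1. [cite: Balaban1985UV3, (5) p.256, (41) p.266, (47) p.267, (64) p.273] -/
theorem _root_.Summit.QuantumFields.YangMills.Theorems.AlphaInputsT3AC.OfV3At.pinnedStep_inner_of_anchored (b₀ p₀ : ℝ) (m : ℕ)
    (ha₁ : θBal F.L γ 𝔠.b₀ 𝔠.p₀ 0 ≤ a₁) (ha₀ : 𝔠.B₃ * θBal F.L γ 𝔠.b₀ 𝔠.p₀ 0 ≤ a₀)
    (hStepA : ∃ (Cu c : ℝ) (A : ℕ), 0 < c ∧
      ∀ (K j : ℕ), 1 ≤ j → j + 2 ≤ K → j + (K - 1) / m ≤ K → ∀ (a : Plaq (F.P K) j),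
        ∀ᵐ V ∂(fieldMeasure (F.P K) K (Matrix.specialUnitaryGroup (Fin 2) ℂ)),
          resDensity F γ K
            ({U : GaugeField (F.P K) 0 (Matrix.specialUnitaryGroup (Fin 2) ℂ) |
                θBal F.L γ b₀ p₀ (K - j) ≤ GaugeGroup.dist1 (GaugeField.plaqHol
                  (Averaging.iter (fun i' => BlockAveraging.blockAvg (P := F.P K) (j := i') ℰp) j U) a)} ∩
              {U : GaugeField (F.P K) 0 (Matrix.specialUnitaryGroup (Fin 2) ℂ) | ∀ i, i < j →
                PlaqSmall (θBal F.L γ b₀ p₀ (K - i))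
                  (Averaging.iter (fun i' => BlockAveraging.blockAvg (P := F.P K) (j := i') ℰp) i U)})
            K V ≤
          Real.exp (-((h.dataT3v3 hc γ hγ hγ1 π).Ecst K K) + Cu) *
            ((F.scheme ℰp γ).β (K - j) ^ A * Real.exp (-(c * B10.pFun b₀ p₀ (Real.sqrt (γ * ((F.L : ℝ)⁻¹) ^ (K - j))) ^ 2)))) :
    ∃ (Cu c : ℝ) (A : ℕ), 0 < c ∧ ∀ (K j : ℕ), 1 ≤ j → j + 2 ≤ K → j + (K - 1) / m ≤ K → ∀ (a : Plaq (F.P K) j) (M : ℝ),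
      (∀ᵐ V ∂(fieldMeasure (F.P K) K (Matrix.specialUnitaryGroup (Fin 2) ℂ)), emlDensity F γ K K V ≤ M) →
      ∀ᵐ V ∂(fieldMeasure (F.P K) K (Matrix.specialUnitaryGroup (Fin 2) ℂ)),
        resDensity F γ K
          ({U : GaugeField (F.P K) 0 (Matrix.specialUnitaryGroup (Fin 2) ℂ) |
              θBal F.L γ b₀ p₀ (K - j) ≤ GaugeGroup.dist1 (GaugeField.plaqHol
                (Averaging.iter (fun i' => BlockAveraging.blockAvg (P := F.P K) (j := i') ℰp) j U) a)} ∩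
            {U : GaugeField (F.P K) 0 (Matrix.specialUnitaryGroup (Fin 2) ℂ) | ∀ i, i < j →
              PlaqSmall (θBal F.L γ b₀ p₀ (K - i))
                (Averaging.iter (fun i' => BlockAveraging.blockAvg (P := F.P K) (j := i') ℰp) i U)})
          K V ≤
        M * Real.exp Cu *
          ((F.scheme ℰp γ).β (K - j) ^ A * Real.exp (-(c * B10.pFun b₀ p₀ (Real.sqrt (γ * ((F.L : ℝ)⁻¹) ^ (K - j))) ^ 2))) := by
  obtain ⟨Cu, c, A, hcpos, hstep⟩ := hStepA
  obtain ⟨Cl, hlow⟩ := exp_Ecst_le_partitionFn_of_packageV3 h hc γ hγ hγ1 π ha₁ ha₀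
  refine ⟨Cu + Cl, c, A, hcpos, fun K j hj1 hjK hjm a M hM => ?_⟩
  have hw : 0 ≤ (F.scheme ℰp γ).β (K - j) ^ A *
      Real.exp (-(c * B10.pFun b₀ p₀ (Real.sqrt (γ * ((F.L : ℝ)⁻¹) ^ (K - j))) ^ 2)) :=
    mul_nonneg (pow_nonneg (F.scheme_β_nonneg ℰp hγ.le (K - j)) A) (Real.exp_nonneg _)
  exact ae_resDensity_le_envelope_of_anchored F hγ.le K _ hw (hstep K j hj1 hjK hjm a) (hlow K) M hM

end SocketV3

end Summit.QuantumFields.YangMills.Theorems.UV3PinnedStepOfAnchored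

end
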